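import Summits.AtomisticToContinuum.FouriersLaw.Theses.PhononMeanFreePath
import Summits.AtomisticToContinuum.FouriersLaw.Theorems.PhononMeanFreePathDefs
import Summits.AtomisticToContinuum.FouriersLaw.Theorems.PhononMeanFreePathCoherentDephasingWeakCouplingIntegrability
import Summits.AtomisticToContinuum.FouriersLaw.Theorems.PhononMeanFreePathCoherentDephasingResponseRegularity
import Summits.AtomisticToContinuum.FouriersLaw.Theorems.PhononMeanFreePathCoherentDephasingMeanFieldDuhamel
import Summits.AtomisticToContinuum.FouriersLaw.Theorems.PhononMeanFreePathCoherentDephasingHarmFluxBound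
import Summits.AtomisticToContinuum.FouriersLaw.Theorems.PhononMeanFreePathCoherentDephasingSiteBookkeeping
import Summits.AtomisticToContinuum.FouriersLaw.Theorems.PhononMeanFreePathCoherentDephasingTelescoping
import Summits.AtomisticToContinuum.FouriersLaw.Theorems.PhononMeanFreePathCoherentDephasingLossComposition

/-!
# `CoherentDephasing` from the local loss bound (line `Sketch`, crux stmt-AtomisticToContinuum-11810)

The CONDITIONAL reduction delivered by line `Sketch` (coherent-field Beer–Lambert; skeleton v4,
`Cruxes/CoherentDephasing/Lines/Sketch.lean`): the crux `PhononMeanFreePath.CoherentDephasing` follows from ONE `N`-uniform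
statement about the Gibbs-averaged linear response field of the kick — the **local loss (Fermi-golden-rule) bound**

  `∃ L N₀ κ>0, ∀ N ≥ N₀, ∀ x ≥ L:  κ · cohEnergy x ≤ siteWork x + γ([x = 0] + [x = N]) ∫₀^∞ m_x²`

(total local loss — work on the mean anharmonic force plus bath dissipation — at least `κ ×` the time-integrated coherent
energy at the site), taken here as the HYPOTHESIS `hLoss` of `coherentDephasing_of_localLossBound` (it is the single open stub
`stub_localLossBound` of the line, of open-problem strength: finite thermal phonon lifetime uniformly in the length; the theorem
is an implication, not a closing of the item). Everything else is in the tree: the Duhamel equations of the response field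
(`…MeanFieldDuhamel`, p90384), their regularity/decay (`…ResponseRegularity`, p89781), the sitewise energy bookkeeping and the
transport bound (`…SiteBookkeeping`, p89923), the `N`-uniform harmonic-flux bound (`…HarmFluxBound`, p91449), the abstract
composition `dissipation_le_geometric_loss` and `∫m_x² ≤ 2E_x` (`…LossComposition`, p93671), `N θ^{(N-c)/L} → 0`
(`…Telescoping`, p87005) and the integrability clause (`pairCorr_sq_integrableOn`). Proof = the v4 assembly: beyond the head the
flux `Ĵ` is non-increasing, non-negative and contracts by `1/(1+κ)` every two bonds, so
`γ∫₀^∞ r_N² ≤ (2γ/κ)·B·(1+κ)^{-⌊(N-1-L)/2⌋}` and `N∫₀^∞ r_N² → 0`.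
-/

noncomputable section

open MeasureTheory Set Filter Topology

namespace Summit.AtomisticToContinuum.FouriersLaw.Theorems.CoherentDephasing.OfLocalLossBound

open Literature.MathematicalPhysics.KineticTheory.HeatConduction (pinnedChain PhaseSpace)
open Summit.AtomisticToContinuum.FouriersLaw.Theses.PhononMeanFreePath (CoherentDephasing)
open Summit.AtomisticToContinuum.FouriersLaw.Theorems.PhononMeanFreePath
open Summit.AtomisticToContinuum.FouriersLaw.Theorems.CoherentDephasing.Telescoping (tendsto_natMul_pow_div)
open Summit.AtomisticToContinuum.FouriersLaw.Theorems.CoherentDephasing.MeanFieldDuhamel (stub_meanFieldDuhamel)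
open Summit.AtomisticToContinuum.FouriersLaw.Theorems.CoherentDephasing.ResponseRegularity (stub_responseRegularity)
open Summit.AtomisticToContinuum.FouriersLaw.Theorems.CoherentDephasing.SiteBookkeeping (stub_siteBookkeeping_of_meanField)
open Summit.AtomisticToContinuum.FouriersLaw.Theorems.CoherentDephasing.HarmFluxBound (stub_harmFluxBound)
open Summit.AtomisticToContinuum.FouriersLaw.Theorems.CoherentDephasing.LossComposition
  (dissipation_le_geometric_loss integral_momResp_sq_le_two_cohEnergy)

/-! ## Indicator sums of the landed site balance -/

section Sums

variable {ω₂ lam β γ T : ℝ}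

/-- The incoming-flux indicator sum at a site `x ≥ 1` is `Ĵ_{x-1}`. [folklore] -/
theorem sum_ite_succ_eq (N : ℕ) (x : Fin (N + 1)) (hlt : (x : ℕ) - 1 < N) (hx : (x : ℕ) ≠ 0) :
    (∑ b : Fin N, if (b : ℕ) + 1 = (x : ℕ) then harmFlux ω₂ lam β γ T N b else 0) =
      harmFlux ω₂ lam β γ T N ⟨(x : ℕ) - 1, hlt⟩ := by
  rw [Finset.sum_eq_single ⟨(x : ℕ) - 1, hlt⟩]
  · simp only; rw [if_pos (by omega)]
  · intro b _ hb; rw [if_neg]; intro h; exact hb (Fin.ext (by simp only; omega))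
  · intro h; exact absurd (Finset.mem_univ _) h

/-- The outgoing-flux indicator sum at a site `x < N` is `Ĵ_x`. [folklore] -/
theorem sum_ite_val_eq_of_lt (N : ℕ) (x : Fin (N + 1)) (hx : (x : ℕ) < N) :
    (∑ b : Fin N, if (b : ℕ) = (x : ℕ) then harmFlux ω₂ lam β γ T N b else 0) =
      harmFlux ω₂ lam β γ T N ⟨(x : ℕ), hx⟩ := by
  rw [Finset.sum_eq_single ⟨(x : ℕ), hx⟩]
  · simp
  · intro b _ hb; rw [if_neg]; intro h; exact hb (Fin.ext (by simpa using h))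
  · intro h; exact absurd (Finset.mem_univ _) h

/-- The outgoing-flux indicator sum at the last site is `0` (no bond leaves it). [folklore] -/
theorem sum_ite_val_eq_zero (N : ℕ) (x : Fin (N + 1)) (hx : ¬ (x : ℕ) < N) :
    (∑ b : Fin N, if (b : ℕ) = (x : ℕ) then harmFlux ω₂ lam β γ T N b else 0) = 0 :=
  Finset.sum_eq_zero fun b _ => by rw [if_neg]; intro h; exact hx (h ▸ b.isLt)

end Sums

/-! ## The conditional reduction -/

/-- **`CoherentDephasing` from the local loss bound.** If for every admissible parameter point there are a head margin `L`,
a threshold `N₀` and a rate `κ > 0` with `κ · cohEnergy x ≤ siteWork x + γ([x=0]+[x=N])∫₀^∞ m_x²` at every site `x ≥ L` of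
every chain with `N ≥ N₀` (the local loss bound of line `Sketch`; an OPEN `N`-uniform statement, taken as hypothesis), then
the coherent channel closes: `(∀ N, r_N² ∈ L¹(0,∞)) ∧ N∫₀^∞ r_N² → 0` for all admissible parameters. Proof: at each
parameter point, `dissipation_le_geometric_loss` applied to the `ℕ`-indexed flux / total loss / site energy of the `(N+1)`-chain
(junk `0` out of range) with the landed balances, transport and flux bound, `A = 2γ` by `∫m_N² ≤ 2E_N`; then
`N (1+κ)^{-⌊(N-1-L)/2⌋} → 0`. [folklore] -/
theorem coherentDephasing_of_localLossBound :
    (∀ ω₂ lam β γ : ℝ, 0 < ω₂ → 0 < lam → 0 < β → 0 < γ → ∀ T : ℝ, 0 < T → ∃ L N₀ : ℕ, ∃ κ : ℝ, 0 < κ ∧ ∀ N : ℕ, N₀ ≤ N → ∀ x : Fin (N + 1), L ≤ (x : ℕ) → κ * cohEnergy ω₂ lam β γ T N x ≤ siteWork ω₂ lam β γ T N x + γ * ((if (x : ℕ) = 0 then 1 else 0) + (if (x : ℕ) = N then 1 else 0)) * ∫ t in Set.Ioi (0 : ℝ), momResp ω₂ lam β γ T N x t ^ 2) → Summit.AtomisticToContinuum.FouriersLaw.Theses.PhononMeanFreePath.CoherentDephasing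 := by
  intro hLoss ω₂ lam β γ hω hl hβ hγ T hT
  refine ⟨fun N => Summit.AtomisticToContinuum.FouriersLaw.Theorems.CoherentDephasing.pairCorr_sq_integrableOn
    hω hl.le hβ hγ hT N, ?_⟩
  obtain ⟨B, hBflux⟩ := stub_harmFluxBound ω₂ lam β γ hω hl hβ hγ T hT
  obtain ⟨L, N₀, κ, hκ, hloss⟩ := hLoss ω₂ lam β γ hω hl hβ hγ T hT
  have hbook := fun N => stub_siteBookkeeping_of_meanField ω₂ lam β γ hω hl hβ hγ T hT N
    (stub_meanFieldDuhamel ω₂ lam β γ hω hl hβ hγ T hT N) (stub_responseRegularity ω₂ lam β γ hω hl hβ hγ T hT N)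
  have h2E := integral_momResp_sq_le_two_cohEnergy ω₂ lam β γ hω hl hβ hγ T hT
  set D : ℕ → ℝ := fun N => γ * ∫ t in Ioi (0 : ℝ), momResp ω₂ lam β γ T N (Fin.last N) t ^ 2 with hD
  set θ : ℝ := 1 / (1 + κ) with hθ
  have hθ0 : 0 ≤ θ := by positivity
  have hθ1 : θ < 1 := by rw [hθ, div_lt_one (by positivity)]; linarith
  have hI0 : ∀ N : ℕ, 0 ≤ ∫ t in Ioi (0 : ℝ), momResp ω₂ lam β γ T N (Fin.last N) t ^ 2 := fun N =>
    setIntegral_nonneg measurableSet_Ioi fun t _ => sq_nonneg _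
  have hgeo : ∀ N : ℕ, N₀ ≤ N → L + 1 ≤ N → D N ≤ 2 * γ / κ * B * θ ^ ((N - 1 - L) / 2) := by
    intro N hN0 hN
    obtain ⟨hbal, htr⟩ := hbook N
    -- `ℕ`-indexed flux `J`, total local loss `S = s_x + [x = N] D_N` (for `x ≥ 1`) and site energy `E`, junk `0` out of range
    refine dissipation_le_geometric_loss
      (fun b => if h : b < N then harmFlux ω₂ lam β γ T N ⟨b, h⟩ else 0)
      (fun x => (if h : x < N + 1 then siteWork ω₂ lam β γ T N ⟨x, h⟩ else 0) + (if x = N then D N else 0))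
      (fun x => if h : x < N + 1 then cohEnergy ω₂ lam β γ T N ⟨x, h⟩ else 0)
      (D N) (2 * γ) B κ N L hκ (by positivity) hN ?_ ?_ ?_ ?_ ?_ ?_ ?_
    · -- `J N = 0`
      rw [dif_neg (lt_irrefl N)]
    · -- head bond `J L ≤ B`
      rw [dif_pos (show L < N by omega)]; exact hBflux N ⟨L, by omega⟩
    · -- site balances beyond the head, read off the bookkeeping stub
      intro x hx1 hx2
      have h := hbal ⟨x, by omega⟩
      rw [sum_ite_succ_eq N _ (show ((⟨x, by omega⟩ : Fin (N + 1)) : ℕ) - 1 < N by simp only; omega)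
        (show ((⟨x, by omega⟩ : Fin (N + 1)) : ℕ) ≠ 0 by simp only; omega)] at h
      simp only at h
      rw [if_neg (by omega), if_neg (by omega)] at h
      rw [dif_pos (show x - 1 < N by omega), dif_pos (show x < N + 1 by omega)]
      by_cases hxN : x = N
      · have hfin : ∀ h : x < N + 1, (⟨x, h⟩ : Fin (N + 1)) = Fin.last N := fun _ => Fin.ext hxN
        rw [sum_ite_val_eq_zero N _ (show ¬ ((⟨x, _⟩ : Fin (N + 1)) : ℕ) < N by simp only; omega),
          if_pos hxN] at h
        rw [dif_neg (show ¬ x < N by omega), if_pos hxN]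
        simp only [hfin] at h ⊢
        simp only [hD]
        linarith
      · rw [sum_ite_val_eq_of_lt N _ (show ((⟨x, _⟩ : Fin (N + 1)) : ℕ) < N by simp only; omega),
          if_neg hxN] at h
        rw [dif_pos (show x < N by omega), if_neg hxN]
        simp only [add_zero, mul_zero] at h
        linarith
    · -- the loss bound (the hypothesis)
      intro x hx1 hx2
      have h := hloss N hN0 ⟨x, by omega⟩ (le_of_lt hx1)
      simp only at h
      rw [if_neg (by omega)] at h
      rw [dif_pos (show x < N + 1 by omega), dif_pos (show x < N + 1 by omega)]
      by_cases hxN : x = N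
      · have hfin : ∀ h : x < N + 1, (⟨x, h⟩ : Fin (N + 1)) = Fin.last N := fun _ => Fin.ext hxN
        rw [if_pos hxN] at h
        rw [if_pos hxN]
        simp only [hfin] at h ⊢
        simp only [hD]
        linarith
      · rw [if_neg hxN] at h
        rw [if_neg hxN]
        simp only [add_zero, mul_zero, zero_mul] at h
        linarith
    · -- `E ≥ 0`
      intro x
      split_ifs
      · exact cohEnergy_nonneg ω₂ lam β γ T N hω.le _
      · exact le_rfl
    · -- transport
      intro b hb
      rw [dif_pos (show b < N by omega), dif_pos (show b < N + 1 by omega), dif_pos (show b + 1 < N + 1 by omega)]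
      exact htr ⟨b, by omega⟩
    · -- `D N ≤ 2γ E_N`
      rw [dif_pos (Nat.lt_succ_self N)]
      have hlast : (⟨N, Nat.lt_succ_self N⟩ : Fin (N + 1)) = Fin.last N := rfl
      rw [hlast]
      simp only [hD]
      have := h2E N (Fin.last N)
      nlinarith [hγ]
  -- squeeze `0 ≤ N ∫ m_N² ≤ (N/γ)(2γ/κ) B θ^{(N-1-L)/2} → 0`
  have hlim := (tendsto_natMul_pow_div θ hθ0 hθ1 2 (by norm_num) (1 + L)).const_mul (2 * γ / κ * B / γ)
  rw [mul_zero] at hlim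
  change Tendsto (fun N : ℕ => (N : ℝ) * ∫ t in Ioi (0 : ℝ), momResp ω₂ lam β γ T N (Fin.last N) t ^ 2) atTop (𝓝 0)
  refine squeeze_zero' (Eventually.of_forall fun N => mul_nonneg (Nat.cast_nonneg N) (hI0 N)) ?_ hlim
  filter_upwards [eventually_ge_atTop (max N₀ (L + 1))] with N hN
  have hN0 : N₀ ≤ N := le_of_max_le_left hN
  have hN1 : L + 1 ≤ N := le_of_max_le_right hN
  have h1 : (N : ℝ) * ∫ t in Ioi (0 : ℝ), momResp ω₂ lam β γ T N (Fin.last N) t ^ 2 = (N : ℝ) * (D N / γ) := by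
    simp only [hD]; field_simp
  rw [h1]
  have h2 : D N / γ ≤ 2 * γ / κ * B / γ * θ ^ ((N - (1 + L)) / 2) := by
    have := div_le_div_of_nonneg_right (hgeo N hN0 hN1) hγ.le
    have e : N - 1 - L = N - (1 + L) := by omega
    rw [e] at this
    calc D N / γ ≤ 2 * γ / κ * B * θ ^ ((N - (1 + L)) / 2) / γ := this
      _ = 2 * γ / κ * B / γ * θ ^ ((N - (1 + L)) / 2) := by ring
  calc (N : ℝ) * (D N / γ) ≤ (N : ℝ) * (2 * γ / κ * B / γ * θ ^ ((N - (1 + L)) / 2)) :=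
      mul_le_mul_of_nonneg_left h2 (Nat.cast_nonneg N)
    _ = 2 * γ / κ * B / γ * ((N : ℝ) * θ ^ ((N - (1 + L)) / 2)) := by ring

end Summit.AtomisticToContinuum.FouriersLaw.Theorems.CoherentDephasing.OfLocalLossBound

end
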